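import Summits.KontsevichZagierPeriods.KontsevichZagierPeriods.Theorems.TerasomaMultiplicationGapSectorBeyondTwelveParity

/-!
# Parity distributions `χ_ℓ` on `ℚ` for every odd prime `ℓ`

Tool file for the crux `GammaHodgeSector` (stmt-KontsevichZagierPeriods-3742; line lead, seat c1):
the level-`15` parity distribution of `…GapSectorBeyondTwelveParity` (`χ(q) = 1` iff `den q` is odd
and divisible by `5`) generalised to an arbitrary odd prime `ℓ` in place of `5`:

* `chiAt ℓ q ∈ ℤ/2` is `1` iff the reduced denominator of `q` is odd and divisible by `ℓ`;
* it is `1`-periodic, even, vanishes on integers, and — for `ℓ` an odd prime — is a PARITY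
  DISTRIBUTION: `∑_{k<n} χ_ℓ((x+k)/n) = χ_ℓ(x)` for every `n ≥ 1` (`sum_chiAt_div`);
* `PhiAt ℓ : ℤ[ℚ × ℚ] →+ ℤ/2`, `[a,b] ↦ χ_ℓ(a) + χ_ℓ(b) + χ_ℓ(a+b)`.

`χ_ℓ` is the `𝔽₂`-valued even ordinary distribution `y ↦ [y₂ = 0]·[y_ℓ ≠ 0]` on `ℚ/ℤ`; these detect
the Yamamoto–Das 2-torsion of the Koblitz–Ogus gap groups level-free (the companion file
`…Negative.Symbol33` uses `ℓ = 11` on the level-`33` Fermat-fourfold class). The denominator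
lemmas are reused from `…GapSectorBeyondTwelveParity`. [folklore]
-/

namespace Summit.KontsevichZagierPeriods.GammaHodgeSectorNegative

open Finset
open Summit.KontsevichZagierPeriods.TerasomaMultiplication.GapSectorBeyondTwelveParity
  (den_add_div_prime card_filter_dvd_eq_one sum_range_mul_split)

/-! ### The weight `chiAt ℓ` -/

/-- The parity weight `χ_ℓ(q) ∈ ℤ/2`: `1` iff the (reduced) denominator of `q` is odd and divisible
by `ℓ`. [folklore] -/
def chiAt (ℓ : ℕ) (q : ℚ) : ZMod 2 := if ¬ 2 ∣ q.den ∧ ℓ ∣ q.den then 1 else 0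

variable {ℓ : ℕ}

/-- Unfolding lemma for `chiAt`. [folklore] -/
theorem chiAt_eq (q : ℚ) : chiAt ℓ q = if ¬ 2 ∣ q.den ∧ ℓ ∣ q.den then 1 else 0 := rfl

/-- `chiAt ℓ` only depends on the denominator. [folklore] -/
theorem chiAt_congr {q r : ℚ} (h : q.den = r.den) : chiAt ℓ q = chiAt ℓ r := by
  simp [chiAt_eq, h]

/-- `chiAt ℓ` is `1`-periodic (integer translates). [folklore] -/
@[simp] theorem chiAt_add_intCast (q : ℚ) (n : ℤ) : chiAt ℓ (q + n) = chiAt ℓ q :=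
  chiAt_congr (Rat.add_intCast_den q n)

/-- `chiAt ℓ` is `1`-periodic (natural translates). [folklore] -/
@[simp] theorem chiAt_add_natCast (q : ℚ) (n : ℕ) : chiAt ℓ (q + n) = chiAt ℓ q :=
  chiAt_congr (Rat.add_natCast_den q n)

/-- `chiAt ℓ` is `1`-periodic. [folklore] -/
@[simp] theorem chiAt_add_one (q : ℚ) : chiAt ℓ (q + 1) = chiAt ℓ q := by
  simpa using chiAt_add_natCast (ℓ := ℓ) q 1

/-- `chiAt ℓ` is even. [folklore] -/
@[simp] theorem chiAt_neg (q : ℚ) : chiAt ℓ (-q) = chiAt ℓ q :=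
  chiAt_congr (Rat.den_neg_eq_den q)

/-- `chiAt ℓ (1 - q) = chiAt ℓ q`. [folklore] -/
@[simp] theorem chiAt_one_sub (q : ℚ) : chiAt ℓ (1 - q) = chiAt ℓ q := by
  rw [sub_eq_neg_add, chiAt_add_one, chiAt_neg]

/-- `chiAt ℓ` vanishes on integers (for `ℓ > 1`). [folklore] -/
@[simp] theorem chiAt_intCast (hℓ : 1 < ℓ) (n : ℤ) : chiAt ℓ n = 0 := by
  have : ¬ ℓ ∣ 1 := fun h => by have := Nat.le_of_dvd one_pos h; omega
  simp [chiAt_eq, this]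

/-- `chiAt ℓ` vanishes on naturals (for `ℓ > 1`). [folklore] -/
@[simp] theorem chiAt_natCast (hℓ : 1 < ℓ) (n : ℕ) : chiAt ℓ n = 0 := by
  have : ¬ ℓ ∣ 1 := fun h => by have := Nat.le_of_dvd one_pos h; omega
  simp [chiAt_eq, this]

/-- `chiAt ℓ 0 = 0` (for `ℓ > 1`). [folklore] -/
@[simp] theorem chiAt_zero (hℓ : 1 < ℓ) : chiAt ℓ 0 = 0 := by
  simpa using chiAt_natCast hℓ 0

/-- `chiAt ℓ 1 = 0` (for `ℓ > 1`). [folklore] -/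
@[simp] theorem chiAt_one (hℓ : 1 < ℓ) : chiAt ℓ 1 = 0 := by
  simpa using chiAt_natCast hℓ 1

/-! ### The parity distribution law -/

/-- The parity distribution law at a PRIME `p` for `χ_ℓ`, `ℓ` an odd prime:
`∑_{k<p} χ_ℓ((x+k)/p) = χ_ℓ(x)`. [folklore] -/
theorem sum_chiAt_div_prime (hℓ : ℓ.Prime) (hℓ2 : ℓ ≠ 2) (x : ℚ) {p : ℕ} (hp : p.Prime) :
    ∑ k ∈ range p, chiAt ℓ ((x + k) / p) = chiAt ℓ x := by
  have hterm : ∀ k : ℕ, chiAt ℓ ((x + k) / p) =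
      if (p : ℤ) ∣ x.num + k * x.den then chiAt ℓ x
      else (if ¬ 2 ∣ p * x.den ∧ ℓ ∣ p * x.den then 1 else 0) := by
    intro k
    rw [chiAt_eq ((x + k) / p), den_add_div_prime x k hp]
    by_cases h : (p : ℤ) ∣ x.num + k * x.den
    · rw [if_pos h, if_pos h, chiAt_eq]
    · rw [if_neg h, if_neg h]
  simp_rw [hterm]
  rw [sum_ite, sum_const, sum_const]
  generalize hG : (if ¬ 2 ∣ p * x.den ∧ ℓ ∣ p * x.den then (1 : ZMod 2) else 0) = G
  have hcard := card_filter_add_card_filter_not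
    (s := range p) (fun k : ℕ => (p : ℤ) ∣ x.num + k * x.den)
  rw [card_range] at hcard
  by_cases hb : p ∣ x.den
  · -- no `k` qualifies: `p ∣ x.num + k x.den` would force `p ∣ x.num`
    have hnone : ((range p).filter fun k : ℕ => (p : ℤ) ∣ x.num + k * x.den) = ∅ := by
      refine filter_false_of_mem fun k _ hk => ?_
      have hkb : (p : ℤ) ∣ (k : ℤ) * x.den := Dvd.dvd.mul_left (Int.natCast_dvd_natCast.mpr hb) _
      have hpa : (p : ℤ) ∣ x.num := (dvd_add_left hkb).mp hk
      have hpa' : p ∣ x.num.natAbs := Int.ofNat_dvd_left.mp hpa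
      have hg : p ∣ Nat.gcd x.num.natAbs x.den := Nat.dvd_gcd hpa' hb
      rw [Nat.Coprime.gcd_eq_one x.reduced] at hg
      exact hp.one_lt.ne' (Nat.dvd_one.mp hg)
    rw [hnone] at hcard ⊢
    simp only [card_empty, zero_add] at hcard
    rw [hcard, card_empty, zero_smul, zero_add]
    rcases hp.eq_two_or_odd' with rfl | hodd
    · -- `p = 2 ∣ x.den`: both sides vanish
      have h2 : (2 : ℕ) ∣ x.den := hb
      have hG0 : G = 0 := by rw [← hG, if_neg (by simp)]
      rw [hG0, smul_zero, chiAt_eq, if_neg (by simp [h2])]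
    · have hp2 : ¬ 2 ∣ p := Nat.two_dvd_ne_zero.mpr (Nat.odd_iff.mp hodd)
      have hsmul : p • G = G := by
        rw [nsmul_eq_mul, ZMod.natCast_eq_one_iff_odd.mpr hodd, one_mul]
      have e2 : (2 ∣ p * x.den) ↔ 2 ∣ x.den := by
        constructor
        · intro h
          rcases (Nat.Prime.dvd_mul Nat.prime_two).mp h with h | h
          · exact absurd h hp2
          · exact h
        · exact fun h => Dvd.dvd.mul_left h p
      have eℓ : (ℓ ∣ p * x.den) ↔ ℓ ∣ x.den := by
        constructor
        · intro h
          rcases (Nat.Prime.dvd_mul hℓ).mp h with h | h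
          · have h5 : p = ℓ := ((Nat.prime_dvd_prime_iff_eq hℓ hp).mp h).symm
            subst h5
            exact hb
          · exact h
        · exact fun h => Dvd.dvd.mul_left h p
      rw [hsmul, ← hG, chiAt_eq]
      simp only [e2, eℓ]
  · rw [card_filter_dvd_eq_one hp x.num x.den hb] at hcard ⊢
    rw [one_smul]
    have hrest : ((range p).filter fun k : ℕ => ¬ (p : ℤ) ∣ x.num + k * x.den).card = p - 1 := by
      omega
    rw [hrest]
    rcases hp.eq_two_or_odd' with rfl | hodd
    · have hG0 : G = 0 := by rw [← hG, if_neg (by simp)]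
      rw [hG0, smul_zero, add_zero]
    · have hne : p ≠ 2 := by
        rintro rfl
        exact (Nat.not_even_iff_odd.mpr hodd) even_two
      rw [nsmul_eq_mul, ZMod.natCast_eq_zero_iff_even.mpr (hp.even_sub_one hne), zero_mul,
        add_zero]

/-- **The parity distribution law** for `χ_ℓ`, `ℓ` an odd prime: `∑_{k<n} χ_ℓ((x+k)/n) = χ_ℓ(x)`
for every `n ≥ 1` and every rational `x`. [folklore] -/
theorem sum_chiAt_div (hℓ : ℓ.Prime) (hℓ2 : ℓ ≠ 2) (n : ℕ) (hn : 0 < n) (x : ℚ) :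
    ∑ k ∈ range n, chiAt ℓ ((x + k) / n) = chiAt ℓ x := by
  induction n using Nat.strong_induction_on generalizing x with
  | _ n ih =>
    rcases Nat.lt_or_ge 1 n with h1 | h1
    · -- `n ≥ 2`: peel off the least prime factor
      have hpr : (n.minFac).Prime := Nat.minFac_prime h1.ne'
      obtain ⟨m, hm⟩ : n.minFac ∣ n := Nat.minFac_dvd n
      have hm0 : 0 < m := by
        rcases Nat.eq_zero_or_pos m with h0 | h0
        · rw [h0, mul_zero] at hm
          omega
        · exact h0
      have hmn : m < n := by
        have h2 : m < n.minFac * m := lt_mul_left hm0 hpr.one_lt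
        rwa [← hm] at h2
      have hmq : (m : ℚ) ≠ 0 := by exact_mod_cast hm0.ne'
      have hgoal : ∑ k ∈ range (n.minFac * m), chiAt ℓ ((x + k) / ((n.minFac * m : ℕ) : ℚ)) =
          chiAt ℓ x := by
        rw [sum_range_mul_split _ n.minFac m]
        calc ∑ i ∈ range n.minFac, ∑ j ∈ range m,
              chiAt ℓ ((x + ((j + m * i : ℕ) : ℚ)) / ((n.minFac * m : ℕ) : ℚ))
            = ∑ j ∈ range m, ∑ i ∈ range n.minFac, chiAt ℓ (((x + j) / m + i) / n.minFac) := by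
              rw [sum_comm]
              refine sum_congr rfl fun j _ => sum_congr rfl fun i _ => ?_
              congr 1
              rw [div_add' _ _ _ hmq, div_div]
              push_cast
              congr 1 <;> ring
          _ = ∑ j ∈ range m, chiAt ℓ ((x + j) / m) :=
              sum_congr rfl fun j _ => sum_chiAt_div_prime hℓ hℓ2 _ hpr
          _ = chiAt ℓ x := ih m hmn hm0 x
      rw [hm]
      exact hgoal
    · -- `n = 1`
      obtain rfl : n = 1 := le_antisymm h1 hn
      simp

/-- Corollary: `∑_{k<n} χ_ℓ(k/n) = 0`. [folklore] -/
theorem sum_chiAt_div_zero (hℓ : ℓ.Prime) (hℓ2 : ℓ ≠ 2) (n : ℕ) (hn : 0 < n) :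
    ∑ k ∈ range n, chiAt ℓ ((k : ℚ) / n) = 0 := by
  have h := sum_chiAt_div hℓ hℓ2 n hn 0
  simpa [chiAt_zero hℓ.one_lt] using h

/-- Corollary: `∑_{k<n} χ_ℓ(s + k/n) = χ_ℓ(n s)`. [folklore] -/
theorem sum_chiAt_add_div (hℓ : ℓ.Prime) (hℓ2 : ℓ ≠ 2) (n : ℕ) (hn : 0 < n) (s : ℚ) :
    ∑ k ∈ range n, chiAt ℓ (s + (k : ℚ) / n) = chiAt ℓ (n * s) := by
  have h := sum_chiAt_div hℓ hℓ2 n hn (n * s)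
  have hnq : (n : ℚ) ≠ 0 := by exact_mod_cast hn.ne'
  rw [← h]
  refine sum_congr rfl fun k _ => ?_
  rw [add_div, mul_div_cancel_left₀ s hnq]

/-! ### The functional `PhiAt ℓ` on Beta symbols -/

/-- The symbol weight `[a,b] ↦ χ_ℓ(a) + χ_ℓ(b) + χ_ℓ(a+b)`. [folklore] -/
def wtAt (ℓ : ℕ) (q : ℚ × ℚ) : ZMod 2 := chiAt ℓ q.1 + chiAt ℓ q.2 + chiAt ℓ (q.1 + q.2)

/-- The additive functional `Φ_ℓ : ℤ[ℚ × ℚ] → ℤ/2` extending `wtAt ℓ`. [folklore] -/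
def PhiAt (ℓ : ℕ) : FreeAbelianGroup (ℚ × ℚ) →+ ZMod 2 := FreeAbelianGroup.lift (wtAt ℓ)

/-- `Φ_ℓ` on a generator. [folklore] -/
@[simp] theorem PhiAt_of (a b : ℚ) :
    PhiAt ℓ (FreeAbelianGroup.of (a, b)) = chiAt ℓ a + chiAt ℓ b + chiAt ℓ (a + b) := by
  simp [PhiAt, wtAt, FreeAbelianGroup.lift_apply_of]

end Summit.KontsevichZagierPeriods.GammaHodgeSectorNegative
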